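import Summits.QuantumFields.YangMills.Theorems.SoloBlindRPCovariance
import Literature.MathematicalPhysics.QuantumFieldTheory.TorusLoopLinkRP
import HarnessLib

/-!
# Reflection positivity of spatial Wilson-loop correlations (solo-QuantumFields-blind, rung D7⁺⁺)

Instance of the covariance form of Osterwalder–Seiler positivity (`wilsonExpectation_timeReflect_mul_ge`,
rung D7⁺) for the observables that define glueball correlators and the static potential: for a
SPATIAL rectangular `R × T` Wilson loop `W_C = (1/N) Re tr ρ(U_C)` in the `(i, j)` plane
(`i, j ≠ 0`) based at a site `x` of the positive-time half `1 ≤ x₀ ≤ L/2` of the even torus, and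
every `β ≥ 0`,

  `⟨W_{θC}⟩ ⟨W_C⟩ ≤ ⟨W_{θC} W_C⟩`,  and for all translates  `⟨W_C⟩² ≤ ⟨W_{θC + v} W_{C + v}⟩`

(`wilsonExpectation_wilsonLoop_sq_le_twoPoint`): the connected correlation of two parallel spatial
Wilson loops of the same shape at any odd time separation is non-negative, uniformly in the volume.
Ingredients proved here: the reflected configuration's holonomy along a spatial loop is the holonomy
of the reflected loop (`rectangleHolonomy_timeReflect`, from the tree's
`StringTension.lineHolonomy_timeReflect_of_ne_zero`), and a spatial
loop observable is positive-time (`isPositiveTimeObservable_wilsonLoop`).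

References: K. Osterwalder, E. Seiler, Ann. Phys. 110 (1978) 440, §2; E. Seiler, LNP 159 (1982) Ch. 2.
[folklore consequences of OS positivity; typed torus statements this unit's]
-/

open MeasureTheory
open Literature.MathematicalPhysics.QuantumFieldTheory Literature.RepresentationTheory.CompactGroups

noncomputable section

namespace Summit.QuantumFields.YangMills.Theorems.SoloBlind

section Loops

variable {d L N : ℕ} [NeZero d] {G : Type*} [Group G]

/-- Time reflection commutes with adding a spatial vector `c • e_i`, `i ≠ 0`. [folklore] -/
theorem timeReflect_add_single_of_ne (x : Site d L) {i : Fin d} (hi : i ≠ 0) (c : ZMod L) :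
    (x + Pi.single i c : Site d L).timeReflect = x.timeReflect + Pi.single i c := by
  funext k
  by_cases hk : k = 0
  · subst hk
    simp [Site.timeReflect, Ne.symm hi]
  · simp [Site.timeReflect, Function.update_of_ne hk, Pi.add_apply]

/-- For a spatial rectangle (`i, j ≠ 0`): `(ΘU)_C = U_{θC}`. [folklore] -/
theorem rectangleHolonomy_timeReflect (U : GaugeConfig d L G) (x : Site d L) {i j : Fin d}
    (hi : i ≠ 0) (hj : j ≠ 0) (R T : ℕ) :
    rectangleHolonomy U.timeReflect x i j R T = rectangleHolonomy U x.timeReflect i j R T := by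
  simp only [rectangleHolonomy, StringTension.lineHolonomy_timeReflect_of_ne_zero U hi,
    StringTension.lineHolonomy_timeReflect_of_ne_zero U hj,
    timeReflect_add_single_of_ne x hi, timeReflect_add_single_of_ne x hj]

/-- A straight spatial line holonomy depends only on the links `(y', k)` with `y'₀ = y₀`. [folklore] -/
theorem lineHolonomy_congr_of_time {U V : GaugeConfig d L G} {k : Fin d} (hk : k ≠ 0) {t : ZMod L}
    (hUV : ∀ (y : Site d L) (k' : Fin d), y 0 = t → k' ≠ 0 → U (y, k') = V (y, k')) :
    ∀ (n : ℕ) (y : Site d L), y 0 = t → lineHolonomy U k n y = lineHolonomy V k n y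
  | 0, _, _ => by simp [lineHolonomy]
  | n + 1, y, hy => by
      have hs : (y.shift k) 0 = t := by rw [WilsonRP.shift_apply_of_ne y (Ne.symm hk)]; exact hy
      simp only [lineHolonomy, hUV y k hy hk, lineHolonomy_congr_of_time hk hUV n (y.shift k) hs]

variable [TopologicalSpace G] [IsTopologicalGroup G] [CompactSpace G] [MeasurableSpace G] [BorelSpace G]
  (ρ : G →* Matrix (Fin N) (Fin N) ℂ)

omit [TopologicalSpace G] [IsTopologicalGroup G] [CompactSpace G] [MeasurableSpace G] [BorelSpace G] in
/-- `W_C(ΘU) = W_{θC}(U)` for spatial loops. [folklore] -/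
theorem wilsonLoop_timeReflect (x : Site d L) {i j : Fin d} (hi : i ≠ 0) (hj : j ≠ 0) (R T : ℕ)
    (U : GaugeConfig d L G) :
    wilsonLoop ρ x i j R T U.timeReflect = wilsonLoop ρ x.timeReflect i j R T U := by
  unfold wilsonLoop
  rw [rectangleHolonomy_timeReflect U x hi hj]

omit [TopologicalSpace G] [IsTopologicalGroup G] [CompactSpace G] [MeasurableSpace G] [BorelSpace G] in
/-- A spatial Wilson loop based in the positive-time half is a positive-time observable. [folklore] -/
theorem isPositiveTimeObservable_wilsonLoop (x : Site d L) {i j : Fin d} (hi : i ≠ 0) (hj : j ≠ 0)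
    (R T : ℕ) (hx1 : 1 ≤ (x 0).val) (hx2 : (x 0).val ≤ L / 2) :
    IsPositiveTimeObservable (wilsonLoop (G := G) ρ x i j R T) := by
  intro U V hUV
  have key : ∀ (y : Site d L) (k : Fin d), y 0 = x 0 → k ≠ 0 → U (y, k) = V (y, k) := by
    intro y k hy hk
    have hs : (y.shift k) 0 = y 0 := WilsonRP.shift_apply_of_ne y (Ne.symm hk)
    refine hUV (y, k) ?_ ?_ ?_ ?_
    · simpa [hy] using hx1
    · simpa [hy] using hx2
    · simpa [hs, hy] using hx1
    · simpa [hs, hy] using hx2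
  unfold wilsonLoop rectangleHolonomy
  rw [lineHolonomy_congr_of_time hi key R x rfl,
    lineHolonomy_congr_of_time hj key T (x + Pi.single i (R : ZMod L)) (StringTension.apply_zero_add_single_of_ne x hi _),
    lineHolonomy_congr_of_time hi key R (x + Pi.single j (T : ZMod L)) (StringTension.apply_zero_add_single_of_ne x hj _),
    lineHolonomy_congr_of_time hj key T x rfl]

end Loops

section LoopTwoPoint

variable {d L N : ℕ} [NeZero d] [NeZero L] {G : Type*} [Group G] [TopologicalSpace G]
  [IsTopologicalGroup G] [CompactSpace G] [MeasurableSpace G] [BorelSpace G]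
  (ρ : G →* Matrix (Fin N) (Fin N) ℂ)

omit [NeZero d] [NeZero L] [MeasurableSpace G] [BorelSpace G] in
/-- `|W_C| ≤ 1` for a continuous matrix model of a compact group. [folklore] -/
theorem abs_wilsonLoop_le_one (hρ : Continuous ρ) (x : Site d L) (i j : Fin d) (R T : ℕ)
    (U : GaugeConfig d L G) : |wilsonLoop ρ x i j R T U| ≤ 1 := by
  unfold wilsonLoop
  have h := CompactGroup.abs_re_trace_le_card ρ hρ (rectangleHolonomy U x i j R T)
  simp only [Fintype.card_fin] at h
  rcases Nat.eq_zero_or_pos N with hN | hN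
  · subst hN; simp
  · have hN' : (0 : ℝ) < N := by exact_mod_cast hN
    rw [abs_mul, abs_inv, abs_of_pos hN', inv_mul_le_iff₀ hN', mul_one]
    exact h

/-- **Reflection positivity of spatial Wilson-loop correlations.**  For `β ≥ 0`, `L` even, a
spatial `R × T` loop (`i, j ≠ 0`) based at `x` with `1 ≤ x₀ ≤ L/2`:
`⟨W_{θC}⟩ ⟨W_C⟩ ≤ ⟨W_{θC} · W_C⟩`. -/
theorem wilsonExpectation_wilsonLoop_timeReflect_mul_ge (hL : Even L) (hρ : Continuous ρ) {β : ℝ}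
    (hβ : 0 ≤ β) (x : Site d L) {i j : Fin d} (hi : i ≠ 0) (hj : j ≠ 0) (R T : ℕ)
    (hx1 : 1 ≤ (x 0).val) (hx2 : (x 0).val ≤ L / 2) :
    wilsonExpectation ρ β (wilsonLoop ρ x.timeReflect i j R T) * wilsonExpectation ρ β (wilsonLoop ρ x i j R T) ≤
      wilsonExpectation ρ β fun U => wilsonLoop ρ x.timeReflect i j R T U * wilsonLoop ρ x i j R T U := by
  have h := wilsonExpectation_timeReflect_mul_ge ρ hL hρ hβ
    (StringTension.measurable_wilsonLoop ρ hρ x i j R T) ⟨1, fun U => abs_wilsonLoop_le_one ρ hρ x i j R T U⟩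
    (isPositiveTimeObservable_wilsonLoop ρ x hi hj R T hx1 hx2)
  simpa only [wilsonLoop_timeReflect ρ x hi hj] using h

/-- **Translated form**: `⟨W_C⟩² ≤ ⟨W_{θC + v} · W_{C + v}⟩` for every `v` — the connected
correlation of two parallel spatial `R × T` loops in the `(i, j)` plane with equal spatial position
and ODD time separation `2x₀ − 1 ∈ {1, 3, …, L − 1}` is non-negative, for all `β ≥ 0`, even `L`. -/
theorem wilsonExpectation_wilsonLoop_sq_le_twoPoint (hL : Even L) (hρ : Continuous ρ) {β : ℝ}
    (hβ : 0 ≤ β) (x : Site d L) {i j : Fin d} (hi : i ≠ 0) (hj : j ≠ 0) (R T : ℕ)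
    (hx1 : 1 ≤ (x 0).val) (hx2 : (x 0).val ≤ L / 2) (v : Site d L) :
    (wilsonExpectation ρ β (wilsonLoop ρ x i j R T)) ^ 2 ≤
      wilsonExpectation ρ β fun U =>
        wilsonLoop ρ (x.timeReflect + v) i j R T U * wilsonLoop ρ (x + v) i j R T U := by
  have h := wilsonExpectation_wilsonLoop_timeReflect_mul_ge ρ hL hρ hβ x hi hj R T hx1 hx2
  rw [wilsonExpectation_wilsonLoop_eq_zero_base ρ β x.timeReflect i j R T,
    ← wilsonExpectation_wilsonLoop_eq_zero_base ρ β x i j R T] at h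
  have ht : wilsonExpectation ρ β (fun U =>
        wilsonLoop ρ (x.timeReflect + v) i j R T U * wilsonLoop ρ (x + v) i j R T U) =
      wilsonExpectation ρ β (fun U =>
        wilsonLoop ρ x.timeReflect i j R T U * wilsonLoop ρ x i j R T U) := by
    rw [← wilsonExpectation_comp_torusConfigShift ρ β (-v) (fun U =>
        wilsonLoop ρ x.timeReflect i j R T U * wilsonLoop ρ x i j R T U)]
    congr 1
    funext U
    simp only [Function.comp_apply, wilsonLoop_torusConfigShift, sub_neg_eq_add]
  rw [ht]
  nlinarith [h]

end LoopTwoPoint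

end Summit.QuantumFields.YangMills.Theorems.SoloBlind

end
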